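import Literature.AlgebraicGeometry.Motives.MumfordTateRankInvariance
import HarnessLib

/-!
# The Mumford–Tate group and the Hodge group of a transported Hodge structure: `MT(e^* H) = e⁻¹ MT(H) e`

Family `hodge`, layer `Literature/AlgebraicGeometry/Motives`. Theorems only; no definition, no named fact.
Companion of `MumfordTateRankInvariance` (which proves the LIE-ALGEBRA form
`HodgeStructure.mumfordTateLieAlgebra_comapEquiv : 𝔪𝔱(e^* H) = e⁻¹ 𝔪𝔱(H) e` and `mtRank_comapEquiv`): this file proves
the GROUP-LEVEL form for the tree's `ℚ`-points groups `HodgeStructure.mumfordTateGroup` /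
`HodgeStructure.hodgeGroup` (`HodgeTensor.lean`: the stabilisers in `GL(V)` of the rational Hodge tensors of type
`(0,0)` in weight `0`, resp. of all types `(p,p)`, Deligne LNM 900 I Prop. 3.4):

* `congr_tensorSpaceAct` — equivariance of the action of `GL` on the tensor spaces `T^{a,b}`: for `e : V ≃ W` and
  `T e = e^{⊗a} ⊗ (e⁻ᵀ)^{⊗b} : T^{a,b} V ≃ T^{a,b} W`, `T e (g · t) = (e g e⁻¹) · (T e t)`
  (functoriality of `V ↦ T^{a,b} V`, Deligne I §3.1);
* `mem_mumfordTateGroup_comapEquiv_iff` — **`g ∈ MT(e^* H) ↔ e g e⁻¹ ∈ MT(H)`**, i.e. `MT(e^* H) = e⁻¹ MT(H) e`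
  (the Hodge tensors of `e^* H` are the `(T e)⁻¹`-images of those of `H`, `tensorSpace_comapEquiv` +
  `comapEquiv_hodgeClasses`);
* `mem_hodgeGroup_comapEquiv_iff` — the same for the Hodge group.

Here `e g e⁻¹ : W ≃ W` is written `e.symm.trans (g.trans e)` (`w ↦ e (g (e⁻¹ w))`).  Consumers: isomorphic
Hodge structures (e.g. `H¹` of a CM-type realisation and the CM-type structure `HodgeStructure.ofCMType Φ`,
`HodgeTheory/CMBettiModel`) have conjugate Mumford–Tate and Hodge groups.

## References

* [Deligne1982HodgeCycles] P. Deligne, Hodge cycles on abelian varieties, LNM 900 (1982), I §3.1 (the tensor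
  spaces `T^{a,b}` and the action of `GL(V)`), Prop. 3.4 (the Mumford–Tate group as the stabiliser of the
  Hodge tensors).
* [Moonen2004MT] B. Moonen, An introduction to Mumford–Tate groups (2004), §4 Key Property 4.5, §5.
-/

noncomputable section

open scoped TensorProduct

universe u

namespace Literature.AlgebraicGeometry.Motives

variable {V W : Type u} [AddCommGroup V] [Module ℚ V] [AddCommGroup W] [Module ℚ W]

/-! ### Equivariance of the action on tensor spaces -/

/-- `e^{⊗a} ∘ g^{⊗a} = (e g e⁻¹)^{⊗a} ∘ e^{⊗a}` on `V^{⊗a}` (functoriality of `⨂`). [cite: Deligne1982HodgeCycles, I §3.1] -/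
theorem piCongr_piCongr_apply (e : V ≃ₗ[ℚ] W) (g : V ≃ₗ[ℚ] V) {a : ℕ} (x : ⨂[ℚ]^a V) :
    PiTensorProduct.congr (fun _ : Fin a ↦ e) (PiTensorProduct.congr (fun _ : Fin a ↦ g) x) =
      PiTensorProduct.congr (fun _ : Fin a ↦ e.symm.trans (g.trans e))
        (PiTensorProduct.congr (fun _ : Fin a ↦ e) x) := by
  induction x using PiTensorProduct.induction_on with
  | smul_tprod r v =>
    simp only [map_smul, PiTensorProduct.congr_tprod, LinearEquiv.trans_apply, LinearEquiv.symm_apply_apply]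
  | add x y hx hy => simp only [map_add, hx, hy]

/-- `(e⁻ᵀ)^{⊗b} ∘ (g⁻ᵀ)^{⊗b} = ((e g e⁻¹)⁻ᵀ)^{⊗b} ∘ (e⁻ᵀ)^{⊗b}` on `(V^∨)^{⊗b}` (the contragredient is functorial).
[cite: Deligne1982HodgeCycles, I §3.1] -/
theorem piCongr_dualMap_piCongr_dualMap_apply (e : V ≃ₗ[ℚ] W) (g : V ≃ₗ[ℚ] V) {b : ℕ}
    (ξ : ⨂[ℚ]^b (Module.Dual ℚ V)) :
    PiTensorProduct.congr (fun _ : Fin b ↦ e.symm.dualMap)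
        (PiTensorProduct.congr (fun _ : Fin b ↦ g.symm.dualMap) ξ) =
      PiTensorProduct.congr (fun _ : Fin b ↦ (e.symm.trans (g.trans e)).symm.dualMap)
        (PiTensorProduct.congr (fun _ : Fin b ↦ e.symm.dualMap) ξ) := by
  induction ξ using PiTensorProduct.induction_on with
  | smul_tprod r φ =>
    simp only [map_smul, PiTensorProduct.congr_tprod]
    congr 2
    funext i
    apply LinearMap.ext
    intro w
    simp [LinearEquiv.dualMap_apply]
  | add x y hx hy => simp only [map_add, hx, hy]

/-- **Equivariance of the action of `GL` on `T^{a,b}`**: for `e : V ≃ W` and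
`T e = e^{⊗a} ⊗ (e⁻ᵀ)^{⊗b} : T^{a,b} V ≃ T^{a,b} W`, `T e (g · t) = (e g e⁻¹) · (T e t)` — the group-level
companion of `tensorSpaceCongr_tensorSpaceDeriv`. [cite: Deligne1982HodgeCycles, I §3.1] -/
theorem congr_tensorSpaceAct (e : V ≃ₗ[ℚ] W) (g : V ≃ₗ[ℚ] V) {a b : ℕ} (t : hodgeTensorSpace V a b) :
    TensorProduct.congr (PiTensorProduct.congr fun _ : Fin a ↦ e)
        (PiTensorProduct.congr fun _ : Fin b ↦ e.symm.dualMap) (tensorSpaceAct g t) =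
      tensorSpaceAct (e.symm.trans (g.trans e))
        (TensorProduct.congr (PiTensorProduct.congr fun _ : Fin a ↦ e)
          (PiTensorProduct.congr fun _ : Fin b ↦ e.symm.dualMap) t) := by
  induction t using TensorProduct.induction_on with
  | zero => simp
  | add x y hx hy => simp only [map_add, hx, hy]
  | tmul x ξ =>
    simp only [tensorSpaceAct, TensorProduct.congr_tmul]
    rw [piCongr_piCongr_apply, piCongr_dualMap_piCongr_dualMap_apply]

/-- Fixing pulled-back tensors: `g` fixes every tensor of `(T e)⁻¹ S` iff `e g e⁻¹` fixes every tensor of `S`.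
[cite: Deligne1982HodgeCycles, I §3.1] -/
theorem forall_tensorSpaceAct_eq_comap_iff (e : V ≃ₗ[ℚ] W) (g : V ≃ₗ[ℚ] V) {a b : ℕ}
    (S : Submodule ℚ (hodgeTensorSpace W a b)) :
    (∀ t ∈ S.comap (TensorProduct.congr (PiTensorProduct.congr fun _ : Fin a ↦ e)
        (PiTensorProduct.congr fun _ : Fin b ↦ e.symm.dualMap)).toLinearMap, tensorSpaceAct g t = t) ↔
      ∀ t ∈ S, tensorSpaceAct (e.symm.trans (g.trans e)) t = t := by
  set T := TensorProduct.congr (PiTensorProduct.congr fun _ : Fin a ↦ e)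
    (PiTensorProduct.congr fun _ : Fin b ↦ e.symm.dualMap) with hT
  refine ⟨fun h t ht ↦ ?_, fun h t ht ↦ ?_⟩
  · have ht' : T.symm t ∈ S.comap T.toLinearMap := by
      rw [Submodule.mem_comap, LinearEquiv.coe_coe, T.apply_symm_apply]
      exact ht
    have h1 := h (T.symm t) ht'
    have h2 := congr_tensorSpaceAct e g (T.symm t)
    rw [h1, ← hT, T.apply_symm_apply] at h2
    exact h2.symm
  · rw [Submodule.mem_comap, LinearEquiv.coe_coe] at ht
    have h2 := congr_tensorSpaceAct e g t
    rw [← hT, h (T t) ht] at h2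
    exact T.injective h2

namespace HodgeStructure

variable {n : ℤ} [HodgeTensorFacts.{u, u}] [Module.Finite ℚ V] [Module.Finite ℚ W]

/-- **The Mumford–Tate group of a transported Hodge structure**: `g ∈ MT(e^* H) ↔ e g e⁻¹ ∈ MT(H)`, i.e.
`MT(e^* H) = e⁻¹ MT(H) e` — the Hodge tensors of `e^* H` are the `(T e)⁻¹`-images of those of `H`
(`tensorSpace_comapEquiv`, `comapEquiv_hodgeClasses`) and the action of `GL` on `T^{a,b}` is equivariant
(`congr_tensorSpaceAct`). [cite: Deligne1982HodgeCycles, I Prop. 3.4] [cite: Moonen2004MT, §4 Key Property 4.5] -/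
theorem mem_mumfordTateGroup_comapEquiv_iff (H : HodgeStructure W n) (e : V ≃ₗ[ℚ] W) (g : V ≃ₗ[ℚ] V) :
    g ∈ (H.comapEquiv e).mumfordTateGroup ↔ e.symm.trans (g.trans e) ∈ H.mumfordTateGroup := by
  simp only [mem_mumfordTateGroup_iff, tensorSpace_comapEquiv, comapEquiv_hodgeClasses]
  exact forall₃_congr fun a b _ ↦ forall_tensorSpaceAct_eq_comap_iff e g _

/-- **The Hodge group of a transported Hodge structure**: `g ∈ Hg(e^* H) ↔ e g e⁻¹ ∈ Hg(H)`, i.e.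
`Hg(e^* H) = e⁻¹ Hg(H) e`. [cite: Deligne1982HodgeCycles, I Prop. 3.4] [cite: Moonen2004MT, §4 Key Property 4.5] -/
theorem mem_hodgeGroup_comapEquiv_iff (H : HodgeStructure W n) (e : V ≃ₗ[ℚ] W) (g : V ≃ₗ[ℚ] V) :
    g ∈ (H.comapEquiv e).hodgeGroup ↔ e.symm.trans (g.trans e) ∈ H.hodgeGroup := by
  simp only [mem_hodgeGroup_iff, tensorSpace_comapEquiv, comapEquiv_hodgeClasses]
  exact forall₃_congr fun a b p ↦ forall_congr' fun _ ↦ forall_tensorSpaceAct_eq_comap_iff e g _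

/-- The transport read from `H`: `g' ∈ MT(H) ↔ e⁻¹ g' e ∈ MT(e^* H)`. [cite: Deligne1982HodgeCycles, I Prop. 3.4] -/
theorem mem_mumfordTateGroup_iff_comapEquiv (H : HodgeStructure W n) (e : V ≃ₗ[ℚ] W) (g' : W ≃ₗ[ℚ] W) :
    g' ∈ H.mumfordTateGroup ↔ e.trans (g'.trans e.symm) ∈ (H.comapEquiv e).mumfordTateGroup := by
  rw [mem_mumfordTateGroup_comapEquiv_iff]
  have : e.symm.trans ((e.trans (g'.trans e.symm)).trans e) = g' := by
    apply LinearEquiv.ext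
    intro w
    simp only [LinearEquiv.trans_apply, LinearEquiv.apply_symm_apply]
  rw [this]

/-- The transport read from `H`, Hodge group: `g' ∈ Hg(H) ↔ e⁻¹ g' e ∈ Hg(e^* H)`.
[cite: Deligne1982HodgeCycles, I Prop. 3.4] -/
theorem mem_hodgeGroup_iff_comapEquiv (H : HodgeStructure W n) (e : V ≃ₗ[ℚ] W) (g' : W ≃ₗ[ℚ] W) :
    g' ∈ H.hodgeGroup ↔ e.trans (g'.trans e.symm) ∈ (H.comapEquiv e).hodgeGroup := by
  rw [mem_hodgeGroup_comapEquiv_iff]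
  have : e.symm.trans ((e.trans (g'.trans e.symm)).trans e) = g' := by
    apply LinearEquiv.ext
    intro w
    simp only [LinearEquiv.trans_apply, LinearEquiv.apply_symm_apply]
  rw [this]

end HodgeStructure

end Literature.AlgebraicGeometry.Motives

end
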